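import Summits.CriticalPhenomena.PercolationContinuityZ3.Theorems.FK.Transplant.KNFreeTargetStepV
import HarnessLib

/-!
# FRONTIER TRANSPLANT, binder 2 (TP_FK): the STEP-IV SUPPLIER INTERFACE `FKStepIVAt` — Kozma–Nitzan's Step-IV
# input of F2 `stepV_in_fkLaw`, quantified over the level data (statement layer of the Step-IV abstraction)

Support file (`--supports stmt-CriticalPhenomena-4575`, helper; ONE `Prop`-valued predicate and its two
monotonicity lemmas — the statement layer of `KNFreeTargetStepIVSupplier.lean`, kept apart from the proofs) of the
FRONTIER TRANSPLANT sub-cell (`fk-continuity/transplant/`, seat `prim-bschramm-fkt-p3`); builds on p205010 (kernel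
theorem, internal audit signed; external expert review pending). No named facts, no sorries; standard axioms.
Registered R62 (cell INBOX l.4588, 2026-08-23); registry row T2s; lead label T2s-A0 (fkt-lead L21, l.4604). Convergent independent scratch: fkt-p4 g154 (`transplant/prim-bschramm-fkt-p4-g154/`, cell INBOX l.4537; NO CONTEST l.4574).

HONEST FRAMING (page 1, cell rule). The transplant's theorem of record `ufsc0_of_freeBoundaryHypothesis_r3`
(p248245) is CONDITIONAL on FH AND on TP_FK = `KNFreeTargetHittable d q p`, both OPEN at the same `p` for `q > 1`
(⇔ GRC Conj. (5.103) via K1; barrier note `Literature.Barriers.CriticalPhenomena.SamePFreeBoundaryCriteria`,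
FBN-01, cited first); the transplant is a typed reduction, not a proof of FK continuity. THIS FILE only NAMES the
Step-IV input of F2 (`KNFreeTargetStepV.lean` :134, hypothesis `hIV`) as a predicate on `(δ, H, M, j₀, R₀)`, so that
Kozma–Nitzan's Lemma 10 for `fkLaw` can be stated ONCE for every supplier (`KNFreeTargetStepIVSupplier.lean`) and
suppliers can be landed separately (comparison = T2w; slabs = memo row T4-SLAB, R60, unfunded). It is NOT a new
hypothesis of the record, NOT a binder, NOT `_r4`; `_r3` « 2 / 0 ☑ », n_open = 2, BINDER-OWNERS, FO-19 NO-GO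
unchanged. Kozma–Nitzan's Step IV is the ONLY step of Lemma 10 that does not transplant to `fkLaw` from same-`p`
free-boundary inputs (CHAIN-MAP §D addenda 2–3; lineage note T2-STEPIV-OBSTACLE): a relay certified under the
shell-pinned law must be exhibited for typical patterns of the FREE thin-shell law (the exchange inequality T2a fixes
the direction).

* `FKStepIVAt q p δ H M j₀ R₀` — with window half-side `M`, from level `j₀` and inflation `R₀` on: for every level
  datum `L = (B, o, Sfin)`, weighting `W` with lattice subbox `D ⊇ B⟨R⟩` at `p` (`LHyp L W p D (R-1)`), nonempty
  target `T ⊆ D` w.r.t. `(B, D, R, H)` and wide level `j` with `j₀ ≤ j ≤ R - M - 2`, the supplier names a shell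
  `S ⊆ Icc (Lo j + 1) (Hi j - 1) ∩ D` containing the face `U(x)` of every potential contact `x ∈ ∂⁺B⟨j⟩`, such that at
  every `x`, under the FREE THIN-SHELL law `fkLaw Sfin (restrW S W) q`, with probability `≥ 1 - 3δ` some `u ∈ U(x)`
  is a `(1-δ)`-reliable relay to `T` inside `D` under the shell-pinned law `fkLaw Sfin (pinW W E(S) ξ) q`.
* `FKStepIVAt.mono` (later level / larger inflation), `FKStepIVAt.mono_tol` (larger tolerance).

## References

* G. Kozma, S. Nitzan, arXiv:2401.12397 (2024), §4 Lemma 10, Step IV (pp. 19–21), Step V (pp. 21–22) [KozmaNitzan2024].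
* G. Grimmett, *The Random-Cluster Model*, Springer 2006, Thm. (3.7), eq. (3.22), Conj. (5.103) [Grimmett2006].
-/

noncomputable section

open MeasureTheory
open scoped ENNReal Classical

namespace Summit.CriticalPhenomena.PercolationContinuityZ3.Theorems.FK

open Literature.Probability.Percolation Literature.Probability.LatticeModels SimpleGraph
open Literature.Probability.Percolation.KozmaNitzan Transplant

variable {d : ℕ}

/-! ### The Step-IV supplier interface -/

/-- **The Step-IV supplier interface `FKStepIVAt q p δ H M j₀ R₀`** (F2's Step-IV input `hIV`, quantified over the
level data): with window half-side `M`, from level `j₀` and inflation `R₀` on, for every level datum `L`, weighting `W`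
with the Lemma-10 hypotheses `LHyp L W p D (R-1)` (lattice subbox `D ⊇ B⟨R⟩` at `p`, source `o ∉ D`), every target
`T ⊆ D` w.r.t. `(B, D, R, H)` and every wide level `j` with `j₀ ≤ j ≤ R - M - 2`, there is a shell `S ⊆ Icc (Lo j + 1) (Hi j - 1)`,
`S ⊆ D`, containing the face `U(x)` of every potential contact `x ∈ ∂⁺B⟨j⟩`, such that for every such `x`: under the
free thin-shell law `fkLaw Sfin (restrW S W) q`, with probability `≥ 1 - 3δ` some `u ∈ U(x)` satisfies
`fkLaw Sfin (pinW W E(S) ξ) q (u ↔ T inside D) > 1 - δ`. At `q = 1` with `P_p`-hittable `H` this is KN's Step IV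
((21) ⟹ (25), supplied by Lemmas 7 and 9); for `q ≥ 1` in the Bernoulli window it is supplied by comparison (F1);
above the slab threshold it is the content of the memo row T4-SLAB.
Interface predicate (definition schema): asserts nothing by itself; audit class as `FKTargetAt`
(`FreeBoundaryHypotheses.lean` :203).
[cite: KozmaNitzan2024, §4 Lemma 10 Step IV (pp. 19–21), Step V (pp. 21–22); Grimmett2006, Thm. (3.7), eq. (3.22)] -/
def FKStepIVAt [NeZero d] (q : ℝ) (p : unitInterval) (δ : ℝ) (H : List (Geom d)) (M j₀ R₀ : ℕ) : Prop :=
  ∀ (L : LData d) (W : Sym2 (Site d) → unitInterval) (D T : Finset (Site d)) (R j : ℕ),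
    LHyp L W p D (R - 1) → R₀ ≤ R → j₀ ≤ j → j + M + 2 ≤ R →
    (∀ k, L.Lo j k + 2 * M + 2 ≤ L.Hi j k) → IsTarget T L.lo L.hi D R H → T ⊆ D → T.Nonempty →
    ∃ S : Finset (Site d), S ⊆ Finset.Icc (L.Lo j + 1) (L.Hi j - 1) ∧ S ⊆ D ∧
      (∀ x ∈ outerBoundary (zdGraph d) (L.X j), L.ufaceX j M x ⊆ S) ∧
      ∀ x ∈ outerBoundary (zdGraph d) (L.X j),
        1 - 3 * δ ≤ (fkLaw L.Sfin (restrW (↑S : Set (Site d)) W) q).real {ω | ∃ u ∈ L.ufaceX j M x,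
          1 - δ < (fkLaw L.Sfin (pinW W (wireSet (↑S : Set (Site d))) ω) q).real
            (⋃ t ∈ T, openConnIn (↑D : Set (Site d)) u t)}

/-- **Monotonicity of the interface in the thresholds**: a supplier from level `j₀` and inflation `R₀` on is a
supplier from any later level `j₀' ≥ j₀` and larger inflation `R₀' ≥ R₀` on. [folklore] -/
theorem FKStepIVAt.mono [NeZero d] {q : ℝ} {p : unitInterval} {δ : ℝ} {H : List (Geom d)} {M j₀ R₀ j₀' R₀' : ℕ}
    (h : FKStepIVAt q p δ H M j₀ R₀) (hj : j₀ ≤ j₀') (hR : R₀ ≤ R₀') : FKStepIVAt q p δ H M j₀' R₀' :=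
  fun L W D T R j hL hR₀ hj₀ hjR hwide htgt hTD hTne =>
    h L W D T R j hL (hR.trans hR₀) (hj.trans hj₀) hjR hwide htgt hTD hTne

/-- **Monotonicity of the interface in the tolerance**: a supplier at tolerance `δ` is a supplier at every
`δ' ≥ δ` (both inequalities it asserts only weaken; `q > 0`). [folklore] -/
theorem FKStepIVAt.mono_tol [NeZero d] {q : ℝ} (hq : 0 < q) {p : unitInterval} {δ δ' : ℝ} {H : List (Geom d)}
    {M j₀ R₀ : ℕ} (h : FKStepIVAt q p δ H M j₀ R₀) (hle : δ ≤ δ') : FKStepIVAt q p δ' H M j₀ R₀ := by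
  intro L W D T R j hL hR₀ hj₀ hjR hwide htgt hTD hTne
  obtain ⟨S, hS, hSD, hUS, hIV⟩ := h L W D T R j hL hR₀ hj₀ hjR hwide htgt hTD hTne
  refine ⟨S, hS, hSD, hUS, fun x hx => ?_⟩
  haveI := isProbabilityMeasure_fkLaw L.Sfin (restrW (↑S : Set (Site d)) W) hq
  refine le_trans ?_ ((hIV x hx).trans (measureReal_mono ?_ (measure_ne_top _ _)))
  · linarith
  · rintro ω ⟨u, hu, hgood⟩
    exact ⟨u, hu, lt_of_le_of_lt (by linarith) hgood⟩

end Summit.CriticalPhenomena.PercolationContinuityZ3.Theorems.FK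

end
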